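import Literature.Analysis.FluidPDE.CompressibleEulerImplosionOriginSeries
import Literature.Analysis.ValidatedNumerics.TaylorModelExpr
import HarnessLib

/-!
# Buckmaster–Cao-Labora–Gómez-Serrano at `γ = 5/3`: parameter-uniform Taylor models of the centre series

Companion of `CompressibleEulerImplosionOriginSeries` (Prop. 2.5 of the paper: the power series
`𝒲(ζ) = ∑ wᵢ(r) ζⁱ` of the profile at the centre `P₀`, `w₀ = A = 1`, coefficients forced by the
recursion (2.12)). For the computer-assisted part of the construction one needs the first `N`
coefficients `wᵢ(r)` UNIFORMLY for `r` in a window `r = r_m + ρ`, `|ρ| ≤ h` (App. B of the paper works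
with interval arithmetic in `r`; here, as in `CompressibleEulerImplosionLeftTMW*`, Taylor models in `ρ`
keep the correlations). This file is the reusable ENGINE: a computable mirror `wModels` of the
recursion (2.12) in the Taylor-model arithmetic of `Literature.Analysis.ValidatedNumerics.TaylorModel`
(`taddI`, `tmulI`, `tsmulInt`, `tdivNat`; the division by the leading coefficient
`lead = (n + 1 + (1 − (−1)ⁿ⁺¹))/3` is a division by a natural number since `A = 1`), and its soundness
theorem `tmem_wModels`: if `R1` encloses `ρ ↦ r(ρ) − 1` then the `i`-th model encloses
`ρ ↦ wᵢ(r(ρ))` for every `i ≤ n`. Everything is reducible in the kernel (`decide`), so that downstream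
certificates (partial sums of the series with enclosed coefficients, sign checks in `ζ` by
`tpoly_pos_of_posOn`) are kernel facts. No facts, no axioms.

[cite: BuckmasterCaolaboraGomezserrano2025, Prop. 2.5, eq. (2.12), App. B]
-/

namespace Literature.Analysis.FluidPDE

namespace BuckmasterCaolaboraGomezserrano2025

namespace OriginSeries

open Finset
open Literature.Analysis.ValidatedNumerics Literature.Analysis.ValidatedNumerics.PolyMP
open Literature.Analysis.ValidatedNumerics.NumericsMP

/-! ### Small Taylor-model helpers -/

/-- Sum of the models `g 0, …, g (n−1)`. [folklore] -/
def tsumI (S : ℕ) (g : ℕ → IPoly) : ℕ → IPoly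
  | 0 => tzero S
  | n + 1 => taddI (tsumI S g n) (g n)

/-- Soundness of `tsumI`: a finite sum of enclosed functions is enclosed. [folklore] -/
theorem tmem_tsumI {S : ℕ} {h : ℚ} {G : ℕ → ℝ → ℝ} {g : ℕ → IPoly} :
    ∀ n : ℕ, (∀ k, k < n → TMem S h (G k) (g k)) →
      TMem S h (fun ρ => ∑ k ∈ range n, G k ρ) (tsumI S g n)
  | 0, _ => by
      have e : (fun ρ : ℝ => ∑ k ∈ range 0, G k ρ) = (0 : ℝ → ℝ) := by funext ρ; simp
      rw [e]; exact tmem_zero S h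
  | n + 1, hg => by
      have ih := tmem_tsumI n fun k hk => hg k (Nat.lt_succ_of_lt hk)
      have hn := hg n (Nat.lt_succ_self n)
      have := tmem_add ih hn
      simpa [tsumI, sum_range_succ] using this

/-- The parity constant `1 − (−1)ⁿ⁺¹ ∈ {0, 2}` of the recursion (2.12), as a natural number. [folklore] -/
def par (n : ℕ) : ℕ := if n % 2 = 0 then 2 else 0

/-- [folklore] -/
theorem par_cast (n : ℕ) : ((par n : ℕ) : ℝ) = 1 - (-1) ^ (n + 1) := by
  unfold par
  by_cases hn : n % 2 = 0
  · have he : Even n := Nat.even_iff.mpr hn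
    rw [if_pos hn, pow_succ, he.neg_one_pow]; norm_num
  · have ho : Odd n := Nat.odd_iff.mpr (by omega)
    rw [if_neg hn, pow_succ, ho.neg_one_pow]; norm_num

/-- Entry `i` of a list of models (the zero model past the end). [folklore] -/
def ent (S : ℕ) (L : List IPoly) (i : ℕ) : IPoly := L.getD i (tzero S)

/-- Model of `cᵢ · fᵢ` (`cᵢ = 1/3` for even `i`, `1` for odd `i`). [cite: BuckmasterCaolaboraGomezserrano2025, eq. (2.11)] -/
def ccTM (i : ℕ) (P : IPoly) : IPoly := if i % 2 = 0 then tdivNat 3 P else P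

/-- Model of `vᵢ(f) = 𝟙_{i=1} + cᵢ fᵢ`. [cite: BuckmasterCaolaboraGomezserrano2025, eq. (2.11)] -/
def vvTM (S : ℕ) (i : ℕ) (P : IPoly) : IPoly :=
  if i = 1 then taddI (tconst (MI.ofInt S 1)) (ccTM i P) else ccTM i P

/-- Model of `dⱼ(f) = (j+1) f_{j+1}` from the model of `f_{j+1}`. [folklore] -/
def ddTM (j : ℕ) (P : IPoly) : IPoly := tsmulInt ((j : ℤ) + 1) P

/-- [folklore] -/
theorem tmem_ccTM {S : ℕ} {h : ℚ} {f : ℝ → ℝ} {P : IPoly} (i : ℕ) (hf : TMem S h f P) :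
    TMem S h (fun ρ => cc i * f ρ) (ccTM i P) := by
  by_cases hi : i % 2 = 0
  · have he : Even i := Nat.even_iff.mpr hi
    have hc : cc i = 1 / 3 := by unfold cc; rw [if_pos he]
    have e : (fun ρ => cc i * f ρ) = fun ρ => f ρ / ((3 : ℕ) : ℝ) := by
      funext ρ; rw [hc]; push_cast; ring
    rw [e, show ccTM i P = tdivNat 3 P by unfold ccTM; rw [if_pos hi]]
    exact tmem_divNat (by norm_num) hf
  · have ho : ¬ Even i := fun he => hi (Nat.even_iff.mp he)
    have hc : cc i = 1 := by unfold cc; rw [if_neg ho]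
    have e : (fun ρ => cc i * f ρ) = f := by funext ρ; rw [hc]; ring
    rw [e, show ccTM i P = P by unfold ccTM; rw [if_neg hi]]
    exact hf

/-- [folklore] -/
theorem tmem_vvTM {S : ℕ} {h : ℚ} {F : ℝ → ℕ → ℝ} {P : IPoly} (i : ℕ) (hf : TMem S h (fun ρ => F ρ i) P) :
    TMem S h (fun ρ => vv (F ρ) i) (vvTM S i P) := by
  have hc := tmem_ccTM i hf
  by_cases hi : i = 1
  · have h1 : TMem S h (fun _ => (1 : ℝ)) (tconst (MI.ofInt S 1)) := by
      have := tmem_const (S := S) (h := h) (MI.mem_ofInt S 1)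
      simpa using this
    have e : (fun ρ => vv (F ρ) i) = fun ρ => (1 : ℝ) + cc i * F ρ i := by
      funext ρ; unfold vv; rw [if_pos hi]
    rw [e, show vvTM S i P = taddI (tconst (MI.ofInt S 1)) (ccTM i P) by unfold vvTM; rw [if_pos hi]]
    exact tmem_add h1 hc
  · have e : (fun ρ => vv (F ρ) i) = fun ρ => cc i * F ρ i := by
      funext ρ; unfold vv; rw [if_neg hi]; ring
    rw [e, show vvTM S i P = ccTM i P by unfold vvTM; rw [if_neg hi]]
    exact hc

/-- [folklore] -/
theorem tmem_ddTM {S : ℕ} {h : ℚ} {F : ℝ → ℕ → ℝ} {P : IPoly} (j : ℕ) (hf : TMem S h (fun ρ => F ρ (j + 1)) P) :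
    TMem S h (fun ρ => dd (F ρ) j) (ddTM j P) := by
  have := tmem_smulInt ((j : ℤ) + 1) hf
  have e : (fun ρ => dd (F ρ) j) = fun ρ => (((j : ℤ) + 1 : ℤ) : ℝ) * F ρ (j + 1) := by
    funext ρ; unfold dd; push_cast; ring
  rw [e]; exact this

/-! ### The mirrored recursion -/

/-- Model of `rest r f n` (the right-hand side of (2.12)) from the list `L` of the models of `f₀, …, f_n`
and the model `R1` of `r − 1`. [cite: BuckmasterCaolaboraGomezserrano2025, eq. (2.12)] -/
def restTM (S : ℕ) (h : ℚ) (D : ℕ) (R1 : IPoly) (L : List IPoly) (n : ℕ) : IPoly :=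
  taddI (taddI (tmulI S h D R1 (ent S L n))
      (tsumI S (fun k => tmulI S h D (vvTM S (k + 1) (ent S L (k + 1)))
        (ddTM (n - (k + 1)) (ent S L (n - (k + 1) + 1)))) n))
    (tdivNat 6 (tsmulInt (par n) (tsumI S (fun k => tmulI S h D (ent S L (k + 1)) (ent S L (n - k))) n)))

/-- Model of `w_{n+1} = −rest/lead`, `lead = (n + 1 + par n)/3` (`A = 1`).
[cite: BuckmasterCaolaboraGomezserrano2025, eq. (2.12)] -/
def nextTM (S : ℕ) (h : ℚ) (D : ℕ) (R1 : IPoly) (L : List IPoly) (n : ℕ) : IPoly :=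
  tsmulInt (-3) (tdivNat (n + 1 + par n) (restTM S h D R1 L n))

/-- **The Taylor models of `w₀(r), …, w_n(r)`** (`A = 1`) on the window `r = r(ρ)`, `|ρ| ≤ h`.
[cite: BuckmasterCaolaboraGomezserrano2025, Prop. 2.5, eq. (2.12)] -/
def wModels (S : ℕ) (h : ℚ) (D : ℕ) (R1 : IPoly) : ℕ → List IPoly
  | 0 => [tconst (MI.ofInt S 1)]
  | n + 1 => wModels S h D R1 n ++ [nextTM S h D R1 (wModels S h D R1 n) n]

variable {S : ℕ} {h : ℚ} {D : ℕ} {R1 : IPoly}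

/-- [folklore] -/
theorem length_wModels : ∀ n, (wModels S h D R1 n).length = n + 1
  | 0 => rfl
  | n + 1 => by simp [wModels, length_wModels n]

/-- [folklore] -/
theorem ent_wModels_of_le {n i : ℕ} (hi : i ≤ n) :
    ent S (wModels S h D R1 (n + 1)) i = ent S (wModels S h D R1 n) i := by
  unfold ent
  simp only [wModels]
  rw [List.getD_eq_getElem?_getD, List.getD_eq_getElem?_getD,
    List.getElem?_append_left (by rw [length_wModels]; omega)]

/-- [folklore] -/
theorem ent_wModels_last (n : ℕ) :
    ent S (wModels S h D R1 (n + 1)) (n + 1) = nextTM S h D R1 (wModels S h D R1 n) n := by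
  unfold ent
  simp only [wModels]
  rw [List.getD_eq_getElem?_getD, List.getElem?_append_right (by rw [length_wModels])]
  simp [length_wModels]

/-! ### Soundness -/

variable {rF : ℝ → ℝ}

/-- The rest of the recursion is enclosed by `restTM`. [cite: BuckmasterCaolaboraGomezserrano2025, eq. (2.12)] -/
theorem tmem_restTM (hS : 0 < S) (h0 : 0 ≤ h) (hR1 : TMem S h (fun ρ => rF ρ - 1) R1)
    {L : List IPoly} {n : ℕ} (hL : ∀ i, i ≤ n → TMem S h (fun ρ => w (rF ρ) 1 i) (ent S L i)) :
    TMem S h (fun ρ => rest (rF ρ) (w (rF ρ) 1) n) (restTM S h D R1 L n) := by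
  -- the three summands
  have hA : TMem S h (fun ρ => (rF ρ - 1) * w (rF ρ) 1 n) (tmulI S h D R1 (ent S L n)) :=
    tmem_mul hS h0 D hR1 (hL n le_rfl)
  have hB : TMem S h (fun ρ => ∑ k ∈ range n, vv (w (rF ρ) 1) (k + 1) * dd (w (rF ρ) 1) (n - (k + 1)))
      (tsumI S (fun k => tmulI S h D (vvTM S (k + 1) (ent S L (k + 1)))
        (ddTM (n - (k + 1)) (ent S L (n - (k + 1) + 1)))) n) := by
    refine tmem_tsumI n fun k hk => ?_
    exact tmem_mul hS h0 D (tmem_vvTM (F := fun ρ i => w (rF ρ) 1 i) (k + 1) (hL (k + 1) hk))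
      (tmem_ddTM (F := fun ρ i => w (rF ρ) 1 i) (n - (k + 1)) (hL _ (by omega)))
  have hC : TMem S h (fun ρ => ((par n : ℤ) : ℝ) * (∑ k ∈ range n, w (rF ρ) 1 (k + 1) * w (rF ρ) 1 (n - k)) / (6 : ℕ))
      (tdivNat 6 (tsmulInt (par n) (tsumI S (fun k => tmulI S h D (ent S L (k + 1)) (ent S L (n - k))) n))) := by
    refine tmem_divNat (by norm_num) (tmem_smulInt (par n : ℤ) (tmem_tsumI n fun k hk => ?_))
    exact tmem_mul hS h0 D (hL (k + 1) hk) (hL (n - k) (by omega))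
  have := tmem_add (tmem_add hA hB) hC
  have e : (fun ρ => rest (rF ρ) (w (rF ρ) 1) n) = fun ρ => (rF ρ - 1) * w (rF ρ) 1 n
      + (∑ k ∈ range n, vv (w (rF ρ) 1) (k + 1) * dd (w (rF ρ) 1) (n - (k + 1)))
      + ((par n : ℤ) : ℝ) * (∑ k ∈ range n, w (rF ρ) 1 (k + 1) * w (rF ρ) 1 (n - k)) / (6 : ℕ) := by
    funext ρ
    have hp : ((par n : ℤ) : ℝ) = 1 - (-1) ^ (n + 1) := by exact_mod_cast par_cast n
    rw [rest, hp]; push_cast; ring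
  rw [e]; exact this

/-- The forced coefficient is enclosed by `nextTM`. [cite: BuckmasterCaolaboraGomezserrano2025, eq. (2.12)] -/
theorem tmem_nextTM (hS : 0 < S) (h0 : 0 ≤ h) (hR1 : TMem S h (fun ρ => rF ρ - 1) R1)
    {L : List IPoly} {n : ℕ} (hL : ∀ i, i ≤ n → TMem S h (fun ρ => w (rF ρ) 1 i) (ent S L i)) :
    TMem S h (fun ρ => w (rF ρ) 1 (n + 1)) (nextTM S h D R1 L n) := by
  have hr := tmem_restTM (D := D) hS h0 hR1 hL
  have hpos : 0 < n + 1 + par n := by omega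
  have := tmem_smulInt (-3) (tmem_divNat hpos hr)
  have e : (fun ρ => w (rF ρ) 1 (n + 1))
      = fun ρ => (((-3 : ℤ)) : ℝ) * (rest (rF ρ) (w (rF ρ) 1) n / ((n + 1 + par n : ℕ) : ℝ)) := by
    funext ρ
    have hl := lead_w (r := rF ρ) (A := (1 : ℝ)) n
    have hp : ((par n : ℕ) : ℝ) = 1 - (-1) ^ (n + 1) := par_cast n
    have hne : ((n : ℝ) + 1 + (1 - (-1) ^ (n + 1))) ≠ 0 := by
      rw [← hp]; exact_mod_cast hpos.ne'
    rw [w_succ, next, hl]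
    push_cast
    rw [hp]
    field_simp
  rw [e]; exact this

/-- **Soundness of the engine.** For every `n` and `i ≤ n`, the `i`-th model of `wModels … n` encloses
`ρ ↦ wᵢ(r(ρ))` on `|ρ| ≤ h`. [cite: BuckmasterCaolaboraGomezserrano2025, Prop. 2.5, eq. (2.12)] -/
theorem tmem_wModels (hS : 0 < S) (h0 : 0 ≤ h) (hR1 : TMem S h (fun ρ => rF ρ - 1) R1) :
    ∀ n i : ℕ, i ≤ n → TMem S h (fun ρ => w (rF ρ) 1 i) (ent S (wModels S h D R1 n) i)
  | 0, i, hi => by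
      have hi0 : i = 0 := Nat.le_zero.mp hi
      subst hi0
      have h1 : TMem S h (fun _ => (1 : ℝ)) (tconst (MI.ofInt S 1)) := by
        have := tmem_const (S := S) (h := h) (MI.mem_ofInt S 1)
        simpa using this
      simpa [ent, wModels] using h1
  | n + 1, i, hi => by
      rcases Nat.lt_or_ge i (n + 1) with hlt | hge
      · have hle : i ≤ n := Nat.lt_succ_iff.mp hlt
        rw [ent_wModels_of_le hle]
        exact tmem_wModels hS h0 hR1 n i hle
      · have hieq : i = n + 1 := le_antisymm hi hge
        subst hieq
        rw [ent_wModels_last]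
        exact tmem_nextTM hS h0 hR1 fun j hj => tmem_wModels hS h0 hR1 n j hj

/-- The standard window set-up: `r(ρ) = r_m + ρ`, `R1 = tvar (r_m − 1)`. [folklore] -/
theorem tmem_rm_sub_one (S : ℕ) (h : ℚ) (rm : ℚ) :
    TMem S h (fun ρ => ((rm : ℝ) + ρ) - 1) (tvar S (ofRat S (rm - 1))) := by
  have := tmem_var (S := S) (h := h) (mem_ofRat S (rm - 1))
  refine (show (fun ρ => (((rm - 1 : ℚ)) : ℝ) + ρ) = fun ρ => ((rm : ℝ) + ρ) - 1 from ?_) ▸ this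
  funext ρ; push_cast; ring

/-- **The engine on a window**: models of `w₀(r_m + ρ), …, w_n(r_m + ρ)` for `|ρ| ≤ h`.
[cite: BuckmasterCaolaboraGomezserrano2025, Prop. 2.5, eq. (2.12), App. B] -/
theorem tmem_wModels_window {S : ℕ} (hS : 0 < S) {h : ℚ} (h0 : 0 ≤ h) (D : ℕ) (rm : ℚ) {n i : ℕ} (hi : i ≤ n) :
    TMem S h (fun ρ => w ((rm : ℝ) + ρ) 1 i) (ent S (wModels S h D (tvar S (ofRat S (rm - 1))) n) i) :=
  tmem_wModels (rF := fun ρ => (rm : ℝ) + ρ) hS h0 (tmem_rm_sub_one S h rm) n i hi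

end OriginSeries

end BuckmasterCaolaboraGomezserrano2025

end Literature.Analysis.FluidPDE
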